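import Literature.Barriers.CriticalPhenomena.KozmaNachmiasOneArm
import Literature.Barriers.CriticalPhenomena.SpanningClustersAboveSixMoments
import Literature.Probability.Percolation.MeanFieldDelta
import HarnessLib

/-!
# Kozma–Nachmias 2011, input (1.1): the volume tail `P_{p_c}(|C(0)| ≥ n) ≤ C/√n` from the
# two-point estimate, granted `γ = 1` — discharge of `KozmaNachmias2011_volumeTail` modulo
# `AizenmanNewman1984_gamma_eq_one`

Barrier catalogue `Literature/Barriers/CriticalPhenomena/` (D-0021), companion of
`KozmaNachmiasOneArm.lean`. That file vendors the first input of the Kozma–Nachmias upper bound,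
(1.1) `P_{p_c}(|C(0)| ≥ n) ≤ C n^{-1/2}` for `d > 6` under the two-point estimate (1.2)
("in [6] it is shown that this estimate implies (1.1)", p. 377; [6] = Barsky–Aizenman 1991), as the
named fact `KozmaNachmias2011_volumeTail`. Here it is reduced to Aizenman–Newman's `γ = 1` under the
triangle condition (`Literature.Probability.Percolation.AizenmanNewman1984_gamma_eq_one`):

* `TwoPointBoundedRatio.triangleCondition` — PROVED: on `ℤ^d`, `d ≥ 7`, the two-point upper bound
  `τ_{p_c}(x,y) ≤ C‖x-y‖^{2-d}` implies the triangle condition `T(p_c) < ∞`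
  (Heydenreich–van der Hofstad 2017, (4.1.1) and Exercise 4.2 / the paragraph after Thm. 4.1:
  `τ_{p_c}(x) ≤ C|x|^{2-d}` with `d > 6` makes the triangle sum converge), by two applications of the
  discrete Riesz convolution bound (`three_chain_le`, `SpanningClustersAboveSixMoments.lean`):
  `Σ_{u,v} τ(0,u)τ(u,v)τ(v,0) ≤ C₁³K²` uniformly over finite ranges;
* `KozmaNachmias2011_volumeTail_of_gamma` — PROVED:
  `AizenmanNewman1984_gamma_eq_one → KozmaNachmias2011_volumeTail`, through the `δ = 2` upper bound
  `real_clusterSizeGe_criticalProb_le_of_gamma` (`MeanFieldDelta.lean`: `γ ≤ 1` and Hutchcroft's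
  Thm. 1.3, which is proved).

So the trust base of `KozmaNachmias2011_oneArmUpper` is now
{`KozmaNachmias2011_thm2`, `AizenmanNewman1984_gamma_eq_one`} plus the derivation of Lemma 2.3 from
them (pp. 382–384 of the source, sibling file to come): `KozmaNachmias2011_oneArmUpper_of_lemma23`.

## References

* G. Kozma, A. Nachmias, J. Amer. Math. Soc. 24 (2011) 375–409: (1.1)–(1.2), p. 377.
* M. Heydenreich, R. van der Hofstad, *Progress in High-Dimensional Percolation and Random Graphs*
  (2017): (4.1.1) (triangle condition), Thm. 4.1 (`δ = 2` under it), (1.2.10).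
* T. Hara, R. van der Hofstad, G. Slade, Ann. Probab. 31 (2003), Prop. 1.7 (i) (convolution bounds).
-/

noncomputable section

namespace Literature.Barriers.CriticalPhenomena

open _root_.MeasureTheory Finset Literature.Probability.LatticeModels Literature.Probability.Percolation

variable {d : ℕ}

/-- **The two-point upper bound implies the triangle condition for `d ≥ 7`**: if
`τ_{p_c}(x,y) ≤ C‖x-y‖^{2-d}` (`x ≠ y`; the upper half of `TwoPointBoundedRatio d`), then
`T(p_c) = Σ_{x,y} τ_{p_c}(0,x)τ_{p_c}(x,y)τ_{p_c}(y,0) < ∞`, since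
`|x|^{2-d} * |x|^{2-d} * |x|^{2-d}` evaluated at `0` is a convergent sum exactly when `d > 6`
(Heydenreich–van der Hofstad 2017, the discussion of (4.1.1): the triangle condition as a
`k`-space / `x`-space convergence condition in `d > 6`). Proof: the partial sums over finite
`U ⊆ ℤ^d × ℤ^d` are bounded by `Σ_{u ∈ U₁} Σ_{v ∈ U₂} τ(0,u)τ(u,v)τ(v,0) ≤ C₁³ K²` (`three_chain_le`).
[cite: HeydenreichVanDerHofstad2017, (4.1.1) and Thm. 4.1] -/
theorem TwoPointBoundedRatio.triangleCondition (hd : 7 ≤ d) (h : TwoPointBoundedRatio d) :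
    TriangleCondition d := by
  classical
  obtain ⟨m, rfl⟩ : ∃ m, d = m + 7 := ⟨d - 7, by omega⟩
  obtain ⟨C', C, hC', hC'C, hb⟩ := h.natPow (by omega)
  set p := criticalProbI (m + 7) with hp
  have hU : ∀ x y : Site (m + 7), tau (m + 7) p x y ≤ max C 1 * rieszWt (m + 5) (x - y) :=
    tau_le_rieszWt_of_upper p fun x y hxy => (hb x y hxy).2
  unfold TriangleCondition
  refine summable_of_sum_le (c := (max C 1) ^ 3 * rieszConvConst (m + 7) ^ 2)
    (fun xy => triangle_summand_nonneg xy) fun U => ?_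
  calc ∑ xy ∈ U, tau (m + 7) p 0 xy.1 * tau (m + 7) p xy.1 xy.2 * tau (m + 7) p xy.2 0
      ≤ ∑ xy ∈ (U.image Prod.fst) ×ˢ (U.image Prod.snd),
          tau (m + 7) p 0 xy.1 * tau (m + 7) p xy.1 xy.2 * tau (m + 7) p xy.2 0 :=
        Finset.sum_le_sum_of_subset_of_nonneg Finset.subset_product
          fun xy _ _ => triangle_summand_nonneg xy
    _ = ∑ u ∈ U.image Prod.fst, ∑ v ∈ U.image Prod.snd,
          tau (m + 7) p 0 u * (tau (m + 7) p u v * tau (m + 7) p v 0) := by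
        rw [Finset.sum_product]
        simp only [mul_assoc]
    _ ≤ (max C 1) ^ 3 * rieszConvConst (m + 7) ^ 2 * rieszWt (m + 1) ((0 : Site (m + 7)) - 0) :=
        three_chain_le p hU 0 0 _ _
    _ = (max C 1) ^ 3 * rieszConvConst (m + 7) ^ 2 := by rw [sub_self, rieszWt_zero, mul_one]

/-- **(1.1) from (1.2), granted `γ = 1`**: on `ℤ^d`, `d ≥ 7`, `TwoPointBoundedRatio d` and
Aizenman–Newman's `γ = 1` under the triangle condition give `P_{p_c}(|C(0)| ≥ n) ≤ C/√n` for all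
`n ≥ 1` (Kozma–Nachmias 2011, p. 377: "in [6] it is shown that this estimate implies (1.1)";
here via the triangle condition and `real_clusterSizeGe_criticalProb_le_of_gamma`).
[cite: KozmaNachmias2011, (1.1) and §1.1 (p. 377)] -/
theorem TwoPointBoundedRatio.real_clusterSizeGe_le (h₁ : AizenmanNewman1984_gamma_eq_one)
    (hd : 7 ≤ d) (h : TwoPointBoundedRatio d) :
    ∃ C : ℝ, ∀ n : ℕ, 1 ≤ n →
      (bondPercolation (zdGraph d) (criticalProbI d)).real (clusterSizeGe (0 : Site d) n) ≤
        C / Real.sqrt n :=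
  real_clusterSizeGe_criticalProb_le_of_gamma h₁ (by omega) (h.triangleCondition hd)

/-- **Discharge of `KozmaNachmias2011_volumeTail` modulo `γ = 1`**:
`AizenmanNewman1984_gamma_eq_one → KozmaNachmias2011_volumeTail`.
[cite: KozmaNachmias2011, (1.1) and §1.1 (p. 377)] -/
theorem KozmaNachmias2011_volumeTail_of_gamma (h₁ : AizenmanNewman1984_gamma_eq_one) :
    KozmaNachmias2011_volumeTail :=
  fun _d hd hτ => hτ.real_clusterSizeGe_le h₁ hd

end Literature.Barriers.CriticalPhenomena

end
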